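import Summits.CriticalPhenomena.PercolationContinuityZ3.Theorems.SahiMasterFamilyEqOffTwo
import Summits.CriticalPhenomena.PercolationContinuityZ3.Theorems.SahiMasterFamilyLowerTransfer

/-!
# The `k → k+1` step off the residual class for DECREASING events (the percolation separations), every `k`

Companion of `SahiMasterFamilyResidualStep.lean` (increasing events) and `SahiMasterFamilyLowerTransfer.lean` (complementation of
configurations `ω ↦ ωᶜ`, `p ↦ 1 − p`) (crux `NoHeavyLowerTail`, stmt-CriticalPhenomena-4575; unit `prim-masterthm-p4`).  The one-cut
rows are Sahi functionals of group SEPARATIONS `D[X|Y]`, decreasing events; here the typed inductive step is stated for them: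
GIVEN `MasterFamilyNonneg (k+2)` [resp. `MasterFamilyEqIff (k+2)`], a family of `k + 3` DECREASING events with a comparable pair ∨ a
CO-CYLINDER member `{ω | Disjoint ω S}` ("all coordinates of `S` closed", e.g. "terminal `b` isolated" `= D[b | V ∖ b]`) ∨ a member
independent of the others ∨ a deleted family in `Z_{k+2}` has `E_{k+3}(μ_p; 1_D) ≥ 0` [resp. `E_{k+3} = 0 ↔ D ∈ Z_{k+3}`, `p` interior]
(`sahiE_ind_lower_nonneg_of_not_residual`, `sahiE_ind_lower_eq_zero_iff_of_not_residual`); unconditional at order 3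
(`sahiE_three_ind_lower_of_not_residual`).  Also the decreasing form of the unconditional off-two zero locus
(`SahiMasterFamilyEqOffTwo`): `sahiE_ind_lower_eq_zero_iff_offTwo` — `n + 2` decreasing events all but at most two of which are
co-cylinders have `E_{n+2} = 0 ↔ Z_{n+2}` (interior `p`), every `n`.  HONEST FRAMING: nothing here asserts `C_k` or (EQ-k) for
`k ≥ 3`. [this work]
-/

set_option autoImplicit false

open Finset
open scoped Classical
open scoped unitInterval

namespace Summit.CriticalPhenomena.PercolationContinuityZ3.Theorems

open Literature.Combinatorics.Sahi2008
open MeasureTheory Function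
open Literature.Probability.LatticeModels (isUpperSet_preimage_compl isLowerSet_preimage_compl)
open Literature.Probability.Percolation (DeterminedBy determinedBy_iff)
open Literature.Probability.Percolation.DecisionTree (ind ind_of_mem ind_of_not_mem ind_nonneg)

variable {ι : Type} [Fintype ι]

/-! ### The step off the residual class, decreasing events -/

omit [Fintype ι] in
/-- The co-cylinder "all coordinates of `S` closed" complements to the cylinder "all coordinates of `S` open". [folklore] -/
theorem preimage_compl_coCylinder (S : Set ι) :
    compl ⁻¹' {ω : Set ι | Disjoint ω S} = {ω : Set ι | S ⊆ ω} := by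
  ext ω
  simp only [Set.mem_preimage, Set.mem_setOf_eq]
  rw [Set.disjoint_compl_left_iff_subset]

omit [Fintype ι] in
/-- The four strata are invariant under complementing configurations (co-cylinders become cylinders). [this work] -/
theorem strata_preimage_compl {k : ℕ} {D : Fin (k + 3) → Set (Set ι)}
    (h : (∃ i j : Fin (k + 3), j ≠ i ∧ D j ⊆ D i) ∨ (∃ (m : Fin (k + 3)) (S : Set ι), D m = {ω : Set ι | Disjoint ω S}) ∨
      (∃ (m : Fin (k + 3)) (F : Finset ι), DeterminedBy (D m) (↑F : Set ι) ∧
        ∀ j, DeterminedBy (D (m.succAbove j)) (↑F : Set ι)ᶜ) ∨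
      (∃ m : Fin (k + 3), SuppZeroFlag (k + 2) (fun j => D (m.succAbove j)))) :
    (∃ i j : Fin (k + 3), j ≠ i ∧ compl ⁻¹' D j ⊆ compl ⁻¹' D i) ∨
      (∃ (m : Fin (k + 3)) (S : Set ι), compl ⁻¹' D m = {ω : Set ι | S ⊆ ω}) ∨
      (∃ (m : Fin (k + 3)) (F : Finset ι), DeterminedBy (compl ⁻¹' D m) (↑F : Set ι) ∧
        ∀ j, DeterminedBy (compl ⁻¹' D (m.succAbove j)) (↑F : Set ι)ᶜ) ∨
      (∃ m : Fin (k + 3), SuppZeroFlag (k + 2) (fun j => compl ⁻¹' D (m.succAbove j))) := by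
  rcases h with ⟨i, j, hij, hsub⟩ | ⟨m, S, hm⟩ | ⟨m, F, hF, hFc⟩ | ⟨m, hZ⟩
  · exact Or.inl ⟨i, j, hij, Set.preimage_mono hsub⟩
  · exact Or.inr (Or.inl ⟨m, S, by rw [hm, preimage_compl_coCylinder]⟩)
  · exact Or.inr (Or.inr (Or.inl ⟨m, F, (determinedBy_preimage_compl_iff _ _).2 hF,
      fun j => (determinedBy_preimage_compl_iff _ _).2 (hFc j)⟩))
  · exact Or.inr (Or.inr (Or.inr ⟨m, (suppZeroFlag_preimage_compl_iff (k + 2) _).2 hZ⟩))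

/-- **Positivity off the residual class, decreasing events (every `k`).**  GIVEN `MasterFamilyNonneg (k+2)` (equivalently its
decreasing form), a family of `k + 3` DECREASING events with a comparable pair, OR a co-cylinder member `{ω | Disjoint ω S}` ("all
coordinates of `S` closed"), OR a member independent of all the others, OR a deleted family in `Z_{k+2}`, has `E_{k+3}(μ_p; 1_D) ≥ 0`.
[this work] -/
theorem sahiE_ind_lower_nonneg_of_not_residual {k : ℕ} (hN : MasterFamilyNonneg (k + 2)) (p : ι → unitInterval)
    (D : Fin (k + 3) → Set (Set ι)) (hD : ∀ j, IsLowerSet (D j))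
    (h : (∃ i j : Fin (k + 3), j ≠ i ∧ D j ⊆ D i) ∨ (∃ (m : Fin (k + 3)) (S : Set ι), D m = {ω : Set ι | Disjoint ω S}) ∨
      (∃ (m : Fin (k + 3)) (F : Finset ι), DeterminedBy (D m) (↑F : Set ι) ∧
        ∀ j, DeterminedBy (D (m.succAbove j)) (↑F : Set ι)ᶜ) ∨
      (∃ m : Fin (k + 3), SuppZeroFlag (k + 2) (fun j => D (m.succAbove j)))) :
    0 ≤ sahiE (bernoulliWeight p) (k + 3) (fun j => ind (D j)) := by
  rw [sahiE_ind_eq_sahiE_ind_preimage_compl]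
  exact sahiE_ind_nonneg_of_not_residual hN _ _ (fun j => isUpperSet_preimage_compl (hD j)) (strata_preimage_compl h)

/-- **The zero locus off the residual class, decreasing events (every `k`).**  GIVEN `MasterFamilyEqIff (k+2)`, for `p` in the open
cube, a family of `k + 3` DECREASING events on one of the four strata has `E_{k+3}(μ_p; 1_D) = 0 ↔ D ∈ Z_{k+3}`. [this work] -/
theorem sahiE_ind_lower_eq_zero_iff_of_not_residual {k : ℕ} (hE : MasterFamilyEqIff (k + 2)) (p : ι → unitInterval)
    (hp : ∀ e, (p e : ℝ) ∈ Set.Ioo (0 : ℝ) 1) (D : Fin (k + 3) → Set (Set ι)) (hD : ∀ j, IsLowerSet (D j))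
    (h : (∃ i j : Fin (k + 3), j ≠ i ∧ D j ⊆ D i) ∨ (∃ (m : Fin (k + 3)) (S : Set ι), D m = {ω : Set ι | Disjoint ω S}) ∨
      (∃ (m : Fin (k + 3)) (F : Finset ι), DeterminedBy (D m) (↑F : Set ι) ∧
        ∀ j, DeterminedBy (D (m.succAbove j)) (↑F : Set ι)ᶜ) ∨
      (∃ m : Fin (k + 3), SuppZeroFlag (k + 2) (fun j => D (m.succAbove j)))) :
    sahiE (bernoulliWeight p) (k + 3) (fun j => ind (D j)) = 0 ↔ SuppZeroFlag (k + 3) D := by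
  rw [sahiE_ind_eq_sahiE_ind_preimage_compl, ← suppZeroFlag_preimage_compl_iff (k + 3) D]
  exact sahiE_ind_eq_zero_iff_of_not_residual hE _ ((symm_mem_Ioo_iff p).2 hp) _
    (fun j => isUpperSet_preimage_compl (hD j)) (strata_preimage_compl h)

/-- **Unconditionally at order 3, decreasing events** (the separations of the one-cut rows): `E_3 ≥ 0` and `E_3 = 0 ↔ Z_3` for every
triple of decreasing events off the residual class. [this work] -/
theorem sahiE_three_ind_lower_of_not_residual (p : ι → unitInterval) (hp : ∀ e, (p e : ℝ) ∈ Set.Ioo (0 : ℝ) 1)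
    (D : Fin 3 → Set (Set ι)) (hD : ∀ j, IsLowerSet (D j))
    (h : (∃ i j : Fin 3, j ≠ i ∧ D j ⊆ D i) ∨ (∃ (m : Fin 3) (S : Set ι), D m = {ω : Set ι | Disjoint ω S}) ∨
      (∃ (m : Fin 3) (F : Finset ι), DeterminedBy (D m) (↑F : Set ι) ∧ ∀ j, DeterminedBy (D (m.succAbove j)) (↑F : Set ι)ᶜ) ∨
      (∃ m : Fin 3, SuppZeroFlag 2 (fun j => D (m.succAbove j)))) :
    0 ≤ sahiE (bernoulliWeight p) 3 (fun j => ind (D j)) ∧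
      (sahiE (bernoulliWeight p) 3 (fun j => ind (D j)) = 0 ↔ SuppZeroFlag 3 D) :=
  ⟨sahiE_ind_lower_nonneg_of_not_residual (masterFamilyNonneg_of_le_two le_rfl) p D hD h,
    sahiE_ind_lower_eq_zero_iff_of_not_residual masterFamilyEqIff_two p hp D hD h⟩

/-! ### The unconditional off-two zero locus, decreasing events -/

/-- **Zero locus with at most two non-co-cylinder slots, decreasing events (every `n`, unconditional).**  For `p` interior and
`n + 2` DECREASING events all but at most two of which are co-cylinders `{ω | Disjoint ω (S_i)}` ("all coordinates of `S_i` closed"):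
`E_{n+2}(μ_p; 1_D) = 0 ↔ D ∈ Z_{n+2}`. [this work] -/
theorem sahiE_ind_lower_eq_zero_iff_offTwo (p : ι → unitInterval) (hp : ∀ e, (p e : ℝ) ∈ Set.Ioo (0 : ℝ) 1) (n : ℕ)
    (D : Fin (n + 2) → Set (Set ι)) (hD : ∀ j, IsLowerSet (D j)) (J : Finset (Fin (n + 2))) (hJ : J.card ≤ 2)
    (S : Fin (n + 2) → Set ι) (hS : ∀ i, i ∉ J → D i = {ω : Set ι | Disjoint ω (S i)}) :
    sahiE (bernoulliWeight p) (n + 2) (fun j => ind (D j)) = 0 ↔ SuppZeroFlag (n + 2) D := by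
  rw [sahiE_ind_eq_sahiE_ind_preimage_compl, ← suppZeroFlag_preimage_compl_iff (n + 2) D]
  exact sahiE_ind_eq_zero_iff_offTwo _ ((symm_mem_Ioo_iff p).2 hp) n _ (fun j => isUpperSet_preimage_compl (hD j)) J hJ S
    fun i hi => by rw [hS i hi, preimage_compl_coCylinder]

end Summit.CriticalPhenomena.PercolationContinuityZ3.Theorems
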